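/-
Copyright (c) 2026 the pub-hodgecm-mathlib formalisation cell (harness21).  Prover seat hodgecm-mathlib-K2Liu-p23 (g2), Track B «K2-LIT»,
#184♮ = hLiu418 = `stmt-HodgeConjecture-24832`; #42F′ FACE-G organ F4 (G-gen), road (E) (RULINGS M-158r/s/u): THE LETTER (FFT) OF THE PER-PLACE STEP
★ `K2LiuArchSWPlaceCyclic.fock_induction_of_pivot`, HYPOTHESIS-FREE (F4 lead K2Liu-p27 (g2) 2026-09-04T23:46:28Z; LEAD F0P6-plan (g14)).
KERNEL: theorems only.
-/
import Summits.HodgeConjecture.HodgeConjecture.Theorems.K2LiuFockInvariantsOfBlocks    -- ★ bridge part 2: `fft_fock_of_fft_blocks`, `mem_span_mul_of_invariant`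
import Summits.HodgeConjecture.HodgeConjecture.Theorems.K2LiuFockBlockFFTTransport    -- ★ bridge part 3: `blockFFT_of_unitaryFFT_fin`, `adjoin_blockContraction_swap`
import Summits.HodgeConjecture.HodgeConjecture.Theorems.K2LiuUnitaryFFTContractions   -- ★ (E-a2)+(E-a3) adapter (K2E1-p10): `isUnitaryInvariant_iff_mem_adjoin`
import Summits.HodgeConjecture.HodgeConjecture.Theorems.K2LiuArchSWPlaceCyclic        -- ★ B3-a ED. 3 (K2Liu-p27): `fock_induction_of_blockFFT_of_pivot`
import HarnessLib

/-!
# Crux `HLiu418`, FACE-G organ F4, road (E): THE FIRST FUNDAMENTAL THEOREM AT THE FOCK INSTANCE, HYPOTHESIS-FREE —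
# a `K_H = U(R) × U(S)`-invariant Fock polynomial is a polynomial in the contractions `C^R_{(p,q)}`, `C^S_{(p,q)}`

Cell `hodgecm-mathlib`, crux item hLiu418 = `stmt-HodgeConjecture-24832`, route of record `HCCMUnconditional`; squad K2 ∕ K2Liu, road `K2_Liu`,
socket #42F′, FACE-G organ F4 (G-gen) under RULING M-158r «(E) COMPACT SEE-SAW + FFT + PBW INDUCTION + `K_H`-AVERAGING» (K2E5-r02 (g6)); F4 lead
K2Liu-p27 (g2), desks K2Liu-p10 (g6) ∕ K2E5-r02 (g6).  THEOREMS ONLY (no `def`, no `instance`, no `notation`, no named-fact hypothesis, no `sorry`);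
lane `--supports stmt-HodgeConjecture-24832 --as helper` (count-neutral helper).

THE ASSEMBLY (all inputs ★): the bridge part 2 ★ `K2LiuFockInvariantsOfBlocks.fft_fock_of_fft_blocks` (tensor invariants = products of invariants;
the (FFT) letter modulo two BLOCK first fundamental theorems `hR`, `hS` in abstract-index currency), part 3 ★ `K2LiuFockBlockFFTTransport`
(`blockFFT_of_unitaryFFT_fin`: a `Fin p`-indexed FFT in (E-a0) currency gives `hR` for every coordinate type of cardinality `p`;
`adjoin_blockContraction_swap`), and K2E1-p10 (g4)'s ★ adapter `K2LiuUnitaryFFTContractions.isUnitaryInvariant_iff_mem_adjoin` (the `U(p)` first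
fundamental theorem on two vectors and two covectors [cite: Weyl1939, Thm. 2.6.A] [cite: GoodmanWallachGTM255, Thm. 5.2.1] = ★ Literature
`ClassicalInvariants.GeneralLinearPolynomialFFTGeneral` ∘ ★ (E-a1) `K2LiuUnitaryZariskiDensity`).

* § 1 **`blockFFT`** — the bridge's block hypothesis, DISCHARGED for every finite coordinate type `R` (labels `Fin 2`): a polynomial in
  `x_{(i,r)}, y_{(j,r)}` invariant under `x ↦ x·c`, `y ↦ y·c̄` (`c ∈ U(R)`) lies in `Algebra.adjoin ℂ {Σ_r x_{(i,r)} y_{(j,r)}}`; `blockFFT_swap` (the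
  `S`-block's indexing).
* § 2 **`fft_fock_span`** — ★ (E-f) `map_mem_of_cyclicLetters`'s letter `hFFT` at the Fock instance, NO hypothesis left:
  `∀ F : MvPolynomial (DPIdx (Fin 2) (Fin 2) R S) ℂ, (∀ c d, linSubst (star ↑(dualPairι (1,(c,d)))) F = F) →
  F ∈ Submodule.span ℂ {x | ∃ ρ τ : List (Fin 2 × Fin 2), x = (ρ.map C^R).prod * (τ.map C^S).prod}`.
* § 3 **`fft_fock_adjoin`** — ★ `K2LiuArchSWPlaceCyclic.fock_induction_of_pivot`'s letter `hFFT` VERBATIM (uncurried `k : U(R) × U(S)`, `Algebra.adjoin`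
  of `range C^R ∪ range C^S`), NO hypothesis left.
* § 4 **`fock_induction_of_pivot'`** — THE PER-PLACE STEP OF ROAD (E) WITH THE PIVOT `hpiv` AS ITS ONLY LETTER: ★ K2Liu-p27's
  `fock_induction_of_blockFFT_of_pivot` with `hR := blockFFT`, `hS := blockFFT_swap` (F4 lead 23:49:50Z «yours or mine»).

After this file the per-place step of road (E) has exactly ONE letter left, the pivot `hpiv` (F4 lead 23:46:28Z ∕ 23:49:50Z).
References: [Howe1989Remarks] §2–§3; [KashiwaraVergne1978] §II; [Weyl1939] Ch. II §6 Thm. 2.6.A; [GoodmanWallachGTM255] §5.2.1 Thm. 5.2.1.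
HONEST LABEL.  Count-neutral helper; it retires nothing by itself: `HC_CM` is proved only modulo the 7 printed citations (2 remaining named inputs:
hLiu418 = `stmt-HodgeConjecture-24832`, h413 = `stmt-HodgeConjecture-24833`) until rung 0 closes.

## References
* [Howe1989Remarks] R. Howe, *Remarks on classical invariant theory*, Trans. AMS 313 (1989), §2–§3.
* [KashiwaraVergne1978] M. Kashiwara, M. Vergne, *On the Segal–Shale–Weil representations and harmonic polynomials*, Invent. Math. 44 (1978), §II.
* [Weyl1939] H. Weyl, *The Classical Groups*, Princeton (1939), Ch. II §6, Thm. 2.6.A.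
* [GoodmanWallachGTM255] R. Goodman, N. R. Wallach, *Symmetry, Representations, and Invariants*, GTM 255 (2009), Thm. 5.2.1.
-/

set_option autoImplicit false
set_option linter.dupNamespace false -- the mandated namespace repeats `HodgeConjecture.HodgeConjecture`

open scoped BigOperators Real
open MvPolynomial Matrix Complex
open Literature.Analysis.SegalBargmann
open Literature.RepresentationTheory.KonnoKonno2007
open Literature.RepresentationTheory.KonnoKonno2007.RealDualPair
open Summit.HodgeConjecture.HodgeConjecture.Cruxes.HLiu418.K2LiuArchSWPlaceCyclic
open Summit.HodgeConjecture.HodgeConjecture.Cruxes.HLiu418.K2LiuFockInvariantsOfBlocks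
open Summit.HodgeConjecture.HodgeConjecture.Cruxes.HLiu418.K2LiuFockBlockFFTTransport
open Summit.HodgeConjecture.HodgeConjecture.Cruxes.HLiu418.K2LiuUnitaryFFTContractions

namespace Summit.HodgeConjecture.HodgeConjecture.Cruxes.HLiu418.K2LiuFockKHInvariantsFFT

variable {R S : Type*} [Fintype R] [DecidableEq R] [Fintype S] [DecidableEq S]

/-! ## § 1 The block first fundamental theorem, discharged for every finite coordinate type -/

omit [Fintype S] [DecidableEq S] in
/-- **THE BLOCK FIRST FUNDAMENTAL THEOREM FOR `U(R)` ON TWO VECTORS AND TWO COVECTORS, EVERY FINITE COORDINATE TYPE `R`**: a polynomial in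
`x_{(i,r)}, y_{(j,r)}` (`i, j < 2`, `r ∈ R`) invariant under `x ↦ x·c`, `y ↦ y·c̄` for every `c ∈ U(R)` lies in the subalgebra generated by the four
contractions `Σ_r x_{(i,r)} y_{(j,r)}` (★ adapter `isUnitaryInvariant_iff_mem_adjoin` at `p = |R|`, transported along `R ≃ Fin |R|` by ★
`blockFFT_of_unitaryFFT_fin`). [cite: Weyl1939, Thm. 2.6.A] [cite: GoodmanWallachGTM255, Thm. 5.2.1] -/
theorem blockFFT (f : MvPolynomial ((Fin 2 × R) ⊕ (Fin 2 × R)) ℂ)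
    (hf : ∀ c : Matrix.unitaryGroup R ℂ, aeval (Sum.elim
        (fun pr : Fin 2 × R => ∑ b : R, X (Sum.inl (pr.1, b)) * C ((c : Matrix R R ℂ) b pr.2))
        (fun qr : Fin 2 × R => ∑ b : R, X (Sum.inr (qr.1, b)) * C ((star (c : Matrix R R ℂ)) qr.2 b)) :
        (Fin 2 × R) ⊕ (Fin 2 × R) → MvPolynomial ((Fin 2 × R) ⊕ (Fin 2 × R)) ℂ) f = f) :
    f ∈ Algebra.adjoin ℂ (Set.range fun ij : Fin 2 × Fin 2 =>
      (∑ r : R, X (Sum.inl (ij.1, r)) * X (Sum.inr (ij.2, r)) : MvPolynomial ((Fin 2 × R) ⊕ (Fin 2 × R)) ℂ)) :=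
  blockFFT_of_unitaryFFT_fin (p := Fintype.card R) rfl (fun f' hf' => (isUnitaryInvariant_iff_mem_adjoin f').mp hf') f hf

omit [Fintype S] [DecidableEq S] in
/-- the block first fundamental theorem with the contractions indexed by `(ij.2, ij.1)` (the `S`-block's indexing in the bridge).
[cite: Weyl1939, Thm. 2.6.A] [cite: GoodmanWallachGTM255, Thm. 5.2.1] -/
theorem blockFFT_swap (f : MvPolynomial ((Fin 2 × R) ⊕ (Fin 2 × R)) ℂ)
    (hf : ∀ c : Matrix.unitaryGroup R ℂ, aeval (Sum.elim
        (fun pr : Fin 2 × R => ∑ b : R, X (Sum.inl (pr.1, b)) * C ((c : Matrix R R ℂ) b pr.2))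
        (fun qr : Fin 2 × R => ∑ b : R, X (Sum.inr (qr.1, b)) * C ((star (c : Matrix R R ℂ)) qr.2 b)) :
        (Fin 2 × R) ⊕ (Fin 2 × R) → MvPolynomial ((Fin 2 × R) ⊕ (Fin 2 × R)) ℂ) f = f) :
    f ∈ Algebra.adjoin ℂ (Set.range fun ij : Fin 2 × Fin 2 =>
      (∑ r : R, X (Sum.inl (ij.2, r)) * X (Sum.inr (ij.1, r)) : MvPolynomial ((Fin 2 × R) ⊕ (Fin 2 × R)) ℂ)) := by
  rw [adjoin_blockContraction_swap]
  exact blockFFT f hf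

/-! ## § 2 The letter (FFT) of ★ (E-f) at the Fock instance, hypothesis-free (span-of-balanced-products currency) -/

/-- **THE FIRST FUNDAMENTAL THEOREM AT THE FOCK INSTANCE (span currency), NO HYPOTHESIS LEFT**: every Fock polynomial
`F ∈ ℂ[DPIdx (Fin 2) (Fin 2) R S]` fixed by all `K_H`-substitutions `linSubst (star ↑(dualPairι (1,(c,d))))` (`c ∈ U(R)`, `d ∈ U(S)`) lies in the
`ℂ`-span of the balanced products `(∏_ρ C^R)(∏_τ C^S)`, `C^R_{(p,q)} = Σ_r X (inl (inl (p,r))) * X (inr (inr (q,r)))`,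
`C^S_{(p,q)} = Σ_s X (inr (inl (p,s))) * X (inl (inr (q,s)))` — the letter `hFFT` of ★ `K2LiuLocalThetaCyclicUniform.map_mem_of_cyclicLetters`.
[cite: Howe1989Remarks, §3] [cite: KashiwaraVergne1978, §II] -/
theorem fft_fock_span (F : MvPolynomial (DPIdx (Fin 2) (Fin 2) R S) ℂ)
    (hF : ∀ (c : Matrix.unitaryGroup R ℂ) (d : Matrix.unitaryGroup S ℂ),
      linSubst (star ((dualPairι ((1, (c, d)) : DPK (Fin 2) (Fin 2) R S) : Matrix.unitaryGroup (DPIdx (Fin 2) (Fin 2) R S) ℂ) :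
        Matrix (DPIdx (Fin 2) (Fin 2) R S) (DPIdx (Fin 2) (Fin 2) R S) ℂ)) F = F) :
    F ∈ Submodule.span ℂ {x : MvPolynomial (DPIdx (Fin 2) (Fin 2) R S) ℂ | ∃ ρ τ : List (Fin 2 × Fin 2),
      x = (ρ.map fun i : Fin 2 × Fin 2 =>
            (∑ r : R, X (Sum.inl (Sum.inl (i.1, r))) * X (Sum.inr (Sum.inr (i.2, r))) : MvPolynomial (DPIdx (Fin 2) (Fin 2) R S) ℂ)).prod *
          (τ.map fun i : Fin 2 × Fin 2 =>
            (∑ s : S, X (Sum.inr (Sum.inl (i.1, s))) * X (Sum.inl (Sum.inr (i.2, s))) : MvPolynomial (DPIdx (Fin 2) (Fin 2) R S) ℂ)).prod} :=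
  fft_fock_of_fft_blocks (P := Fin 2) (Q := Fin 2) (fun f hf => blockFFT f hf) (fun g hg => blockFFT_swap g hg) F hF

/-! ## § 3 The letter (FFT) of ★ `fock_induction_of_pivot`, hypothesis-free (`Algebra.adjoin` currency, uncurried `K_H`) -/

/-- **THE FIRST FUNDAMENTAL THEOREM AT THE FOCK INSTANCE (`Algebra.adjoin` currency, `k : U(R) × U(S)`), NO HYPOTHESIS LEFT** — VERBATIM the letter
`hFFT` of ★ `K2LiuArchSWPlaceCyclic.fock_induction_of_pivot`: a Fock polynomial fixed by all `linSubst (star ↑(dualPairι (1,k)))`, `k ∈ U(R) × U(S)`,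
lies in `Algebra.adjoin ℂ (range C^R ∪ range C^S)`. [cite: Howe1989Remarks, §3] [cite: KashiwaraVergne1978, §II] -/
theorem fft_fock_adjoin (F : MvPolynomial (DPIdx (Fin 2) (Fin 2) R S) ℂ)
    (hF : ∀ k : Matrix.unitaryGroup R ℂ × Matrix.unitaryGroup S ℂ,
      linSubst (star ((dualPairι ((1, k) : DPK (Fin 2) (Fin 2) R S) : Matrix.unitaryGroup (DPIdx (Fin 2) (Fin 2) R S) ℂ) :
        Matrix (DPIdx (Fin 2) (Fin 2) R S) (DPIdx (Fin 2) (Fin 2) R S) ℂ)) F = F) :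
    F ∈ Algebra.adjoin ℂ
      (Set.range (fun i : Fin 2 × Fin 2 =>
          (∑ r : R, X (Sum.inl (Sum.inl (i.1, r))) * X (Sum.inr (Sum.inr (i.2, r))) : MvPolynomial (DPIdx (Fin 2) (Fin 2) R S) ℂ)) ∪
        Set.range (fun i : Fin 2 × Fin 2 =>
          (∑ s : S, X (Sum.inr (Sum.inl (i.1, s))) * X (Sum.inl (Sum.inr (i.2, s))) : MvPolynomial (DPIdx (Fin 2) (Fin 2) R S) ℂ))) := by
  have h := fft_fock_span F fun c d => hF (c, d)
  rw [← Subalgebra.mem_toSubmodule]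
  refine (Submodule.span_le.mpr ?_) h
  rintro x ⟨ρ, τ, rfl⟩
  rw [SetLike.mem_coe, Subalgebra.mem_toSubmodule]
  refine Subalgebra.mul_mem _ (Subalgebra.list_prod_mem _ fun y hy => ?_) (Subalgebra.list_prod_mem _ fun y hy => ?_)
  · obtain ⟨i, -, rfl⟩ := List.mem_map.mp hy
    exact Algebra.subset_adjoin (Set.mem_union_left _ ⟨i, rfl⟩)
  · obtain ⟨i, -, rfl⟩ := List.mem_map.mp hy
    exact Algebra.subset_adjoin (Set.mem_union_right _ ⟨i, rfl⟩)

/-- **THE FIRST FUNDAMENTAL THEOREM AT THE FOCK INSTANCE (`Algebra.adjoin` currency, curried `c`, `d`)**, NO HYPOTHESIS LEFT.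
[cite: Howe1989Remarks, §3] [cite: KashiwaraVergne1978, §II] -/
theorem fft_fock_adjoin' (F : MvPolynomial (DPIdx (Fin 2) (Fin 2) R S) ℂ)
    (hF : ∀ (c : Matrix.unitaryGroup R ℂ) (d : Matrix.unitaryGroup S ℂ),
      linSubst (star ((dualPairι ((1, (c, d)) : DPK (Fin 2) (Fin 2) R S) : Matrix.unitaryGroup (DPIdx (Fin 2) (Fin 2) R S) ℂ) :
        Matrix (DPIdx (Fin 2) (Fin 2) R S) (DPIdx (Fin 2) (Fin 2) R S) ℂ)) F = F) :
    F ∈ Algebra.adjoin ℂ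
      (Set.range (fun i : Fin 2 × Fin 2 =>
          (∑ r : R, X (Sum.inl (Sum.inl (i.1, r))) * X (Sum.inr (Sum.inr (i.2, r))) : MvPolynomial (DPIdx (Fin 2) (Fin 2) R S) ℂ)) ∪
        Set.range (fun i : Fin 2 × Fin 2 =>
          (∑ s : S, X (Sum.inr (Sum.inl (i.1, s))) * X (Sum.inl (Sum.inr (i.2, s))) : MvPolynomial (DPIdx (Fin 2) (Fin 2) R S) ℂ))) :=
  fft_fock_adjoin F fun k => hF k.1 k.2

/-! ## § 4 The per-place step of road (E) with the pivot as its only letter -/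

/-- **THE PER-PLACE STEP OF ROAD (E), RESIDUE = THE PIVOT ALONE**: ★ K2Liu-p27's `fock_induction_of_blockFFT_of_pivot` with both block first
fundamental theorems discharged (`hR := blockFFT`, `hS := blockFFT_swap`): a property `Good` of Fock polynomials closed under `0, +, •`, under the sixteen
`𝔭^±` symbol operators of ★ (E-b), and saturated for the section functional `SW ∘ B⁻¹`, which holds at the vacuum `1`, holds at EVERY Fock polynomial —
provided the section functional is `K_H`-semi-invariant (`hpiv`). [cite: Howe1989Remarks, §3] [cite: KashiwaraVergne1978, §II] -/
theorem fock_induction_of_pivot' (e : VacExponents) {W : Type*} [AddCommGroup W] [Module ℂ W]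
    (SW : SchwartzMap (DPIdx (Fin 2) (Fin 2) R S → ℝ) ℂ →ₗ[ℂ] W)
    (hpiv : ∀ (k : Matrix.unitaryGroup R ℂ × Matrix.unitaryGroup S ℂ) (v : SchwartzMap (DPIdx (Fin 2) (Fin 2) R S → ℝ) ℂ),
      SW (κOp R S e ((1, k) : DPK (Fin 2) (Fin 2) R S) v) = vacScalar e ((1, k) : DPK (Fin 2) (Fin 2) R S) • SW v)
    {Good : MvPolynomial (DPIdx (Fin 2) (Fin 2) R S) ℂ → Prop} (h0 : Good 0) (hadd : ∀ v w, Good v → Good w → Good (v + w))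
    (hsmul : ∀ (c : ℂ) v, Good v → Good (c • v)) (hbase : Good 1)
    (hAp_good : ∀ (i : Fin 2 × Fin 2) (F : MvPolynomial (DPIdx (Fin 2) (Fin 2) R S) ℂ), Good F →
      Good ((((2 * (π : ℂ)⁻¹ * I : ℂ) • (∑ s : S, pderivLin (Sum.inr (Sum.inl (i.1, s)) : DPIdx (Fin 2) (Fin 2) R S) ∘ₗ pderivLin (Sum.inl (Sum.inr (i.2, s)))) -
          (2 * π * I : ℂ) • LinearMap.mulLeft ℂ (∑ r : R, X (Sum.inl (Sum.inl (i.1, r))) * X (Sum.inr (Sum.inr (i.2, r))) : MvPolynomial (DPIdx (Fin 2) (Fin 2) R S) ℂ))) F))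
    (hAm_good : ∀ (i : Fin 2 × Fin 2) (F : MvPolynomial (DPIdx (Fin 2) (Fin 2) R S) ℂ), Good F →
      Good ((((2 * π * I : ℂ) • LinearMap.mulLeft ℂ (∑ s : S, X (Sum.inr (Sum.inl (i.1, s))) * X (Sum.inl (Sum.inr (i.2, s))) : MvPolynomial (DPIdx (Fin 2) (Fin 2) R S) ℂ) -
        (2 * (π : ℂ)⁻¹ * I : ℂ) • ∑ r : R, pderivLin (Sum.inl (Sum.inl (i.1, r)) : DPIdx (Fin 2) (Fin 2) R S) ∘ₗ pderivLin (Sum.inr (Sum.inr (i.2, r))))) F))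
    (hsec : ∀ v v' : MvPolynomial (DPIdx (Fin 2) (Fin 2) R S) ℂ, SW (binvPi v) = SW (binvPi v') → Good v → Good v')
    (F : MvPolynomial (DPIdx (Fin 2) (Fin 2) R S) ℂ) : Good F :=
  fock_induction_of_blockFFT_of_pivot R S e SW hpiv (fun f hf => blockFFT f hf) (fun g hg => blockFFT_swap g hg) h0 hadd hsmul hbase
    hAp_good hAm_good hsec F

end Summit.HodgeConjecture.HodgeConjecture.Cruxes.HLiu418.K2LiuFockKHInvariantsFFT
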